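import Literature.NumberTheory.GaloisRepresentations.IdeleClassGroupLimit
import HarnessLib

/-!
# `C̄ = lim→ C_E` as a discrete `Γ_F`-module: the action of `Gal(F̄/F)`, open stabilisers, and `H⁰(Gal(F̄/E), C̄) = C_E`
# (Harari, *Galois Cohomology and CFT* §13.1; Tate, C–F VII §8 Prop. 8.1, §11.1)

Topic `NumberTheory/GaloisRepresentations`; namespace `Literature.NumberTheory.GaloisRepresentations.IdeleClassBar`.
Sequel to `IdeleClassGroupLimit.lean` (`GalLayer`, `layerClass`, `transHom`, `classBar`, `ofLayer`, `ofLayer_injective`,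
`exists_ofLayer`).  Definitions with bodies (`layerAct`, `barAct`, the representation `barRep`) and theorems; NO named
fact, no `sorry`, no instance, no notation.

Mathematics.  `Γ_F = Gal(F̄/F)` (`AlgebraicClosure F ≃ₐ[F] AlgebraicClosure F`, Krull topology) acts on each layer
`C_E` through `Γ_F → Gal(E/F)`, `σ ↦ σ|_E` (`AlgEquiv.restrictNormal`), compatibly with the transition maps (tree
`classGalAct_classBaseChange_tower`: `g • ι(a) = ι(g|_E • a)`), hence on the limit (§4, `barRep : Representation ℤ Γ_F C̄`).
Every element of `C̄` comes from a layer `C_E` and is therefore fixed by the open subgroup `Gal(F̄/E)`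
(`IntermediateField.fixingSubgroup_isOpen`): `C̄` is a discrete `Γ_F`-module (§5).  Finally (§6) the fixed points of
`Gal(F̄/E)` are exactly `C_E`: an element of a bigger layer `C_M` fixed by `Gal(F̄/E)` is fixed by `Gal(M/E)` (every
`τ ∈ Gal(M/E)` lifts to `Γ_F`, `AlgEquiv.restrictNormalHom_surjective`), hence comes from `C_E` by Galois descent for idèle
classes (tree `exists_classBaseChange_eq_of_forall_classGalAct_eq`, Tate VII §8 Prop. 8.1 / Neukirch III (2.7)) — Harari
§13.1's `C_K = C^{Gal(k̄/K)}`, C–F VII §11.1 [held copy p0232]: "We pass to the limit and let `E → K̄`".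

## What is formalised (`F : Type` a number field, `Γ = AlgebraicClosure F ≃ₐ[F] AlgebraicClosure F`)

* §4 `layerAct` (+ `layerAct_apply`, `toMul_layerAct`, `layerAct_one`, `layerAct_mul`), `restrictNormal_restrictNormal`,
  **`transHom_layerAct`** (compatibility), `barAct` (+ `barAct_ofLayer`, `barAct_one`, `barAct_mul`),
  **`barRep : Representation ℤ Γ (classBar F)`** (+ `barRep_apply`, `barRep_ofLayer`).
* §5 `restrictNormal_eq_one_of_mem_fixingSubgroup`, `layerAct_eq_self_of_mem_fixingSubgroup`,
  `barRep_ofLayer_of_mem_fixingSubgroup`, **`exists_fixingSubgroup_le_stabilizer`** (discreteness).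
* §6 `exists_transHom_eq_of_forall_classGalAct_eq`, `exists_restrictNormal_eq`,
  **`exists_ofLayer_eq_of_forall_mem_fixingSubgroup`**, **`setOf_forall_mem_fixingSubgroup_eq_range`**
  (`C̄^{Gal(F̄/E)} = C_E`), `setOf_forall_eq_range_bot` (`C̄^{Γ_F} = C_F`).

## References
* D. Harari, *Galois Cohomology and Class Field Theory*, Universitext, Springer (2020), §13.1. [Harari2020]
* J. W. S. Cassels, A. Fröhlich (eds.), *Algebraic Number Theory* (1967), Ch. VII (J. Tate) §1.1, §8 Prop. 8.1, §11.1.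
  [CasselsFrohlichANT1967]
* J. Neukirch, *Class Field Theory — The Bonn Lectures* (2013), Part III §2 (2.7). [Neukirch2013]
-/

noncomputable section

open NumberField
open Literature.NumberTheory.Automorphic Literature.NumberTheory.Automorphic.IdeleClassGroup
open Literature.NumberTheory.NumberFields
open scoped Classical

namespace Literature.NumberTheory.GaloisRepresentations

namespace IdeleClassBar

variable {F : Type} [Field F] [NumberField F]

/-! ## §4. The action of `Γ_F = Gal(F̄/F)` on `C̄` -/

omit [NumberField F] in
/-- `E ⊆ E' ⊆ F̄` is a scalar tower for `algebraOfLE`. [cite: Harari2020, §13.1] -/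
theorem GalLayer.isScalarTower_of_le_top {E E' : GalLayer F} (h : E ≤ E') :
    letI := GalLayer.algebraOfLE h
    IsScalarTower E.1 E'.1 (AlgebraicClosure F) :=
  letI := GalLayer.algebraOfLE h
  IsScalarTower.of_algebraMap_eq fun _ => rfl

variable (F) in
/-- **The action of `σ ∈ Γ_F` on the layer `C_E`**, through `Γ_F → Gal(E/F)`, `σ ↦ σ|_E` (Harari §13.1: `Γ_k` acts
on `C = lim C_K` through its finite quotients). [cite: Harari2020, §13.1] -/
def layerAct (E : GalLayer F) (σ : AlgebraicClosure F ≃ₐ[F] AlgebraicClosure F) :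
    layerClass F E →+ layerClass F E :=
  haveI := E.numberField
  haveI := E.isGalois
  ((IdeleClassGroup.galoisRep F E.1).ρ (σ.restrictNormal E.1)).toAddMonoidHom

/-- Formula for `layerAct`. [cite: Harari2020, §13.1] -/
theorem layerAct_apply (E : GalLayer F) (σ : AlgebraicClosure F ≃ₐ[F] AlgebraicClosure F) (x : layerClass F E) :
    layerAct F E σ x =
      (haveI := E.numberField; haveI := E.isGalois;
        Additive.ofMul (classGalAct (σ.restrictNormal E.1) (Additive.toMul x : IdeleClassGroup E.1))) :=
  rfl

/-- Formula for `layerAct` (multiplicatively). [cite: Harari2020, §13.1] -/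
theorem toMul_layerAct (E : GalLayer F) (σ : AlgebraicClosure F ≃ₐ[F] AlgebraicClosure F) (x : layerClass F E) :
    (haveI := E.numberField; (Additive.toMul (layerAct F E σ x) : IdeleClassGroup E.1)) =
      (haveI := E.numberField; haveI := E.isGalois;
        classGalAct (σ.restrictNormal E.1) (Additive.toMul x : IdeleClassGroup E.1)) :=
  rfl

/-- `layerAct E 1 = id`. [cite: Harari2020, §13.1] -/
theorem layerAct_one (E : GalLayer F) (x : layerClass F E) : layerAct F E 1 x = x := by
  haveI := E.numberField
  haveI := E.isGalois
  rw [layerAct_apply]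
  have h1 : (1 : AlgebraicClosure F ≃ₐ[F] AlgebraicClosure F).restrictNormal E.1 = 1 :=
    map_one (AlgEquiv.restrictNormalHom E.1)
  rw [h1, classGalAct_one_apply]
  rfl

/-- `layerAct E (σ τ) = layerAct E σ ∘ layerAct E τ`. [cite: Harari2020, §13.1] -/
theorem layerAct_mul (E : GalLayer F) (σ τ : AlgebraicClosure F ≃ₐ[F] AlgebraicClosure F) (x : layerClass F E) :
    layerAct F E (σ * τ) x = layerAct F E σ (layerAct F E τ x) := by
  haveI := E.numberField
  haveI := E.isGalois
  simp only [layerAct_apply, toMul_ofMul, classGalAct_classGalAct]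
  have hm : (σ * τ).restrictNormal E.1 = σ.restrictNormal E.1 * τ.restrictNormal E.1 :=
    map_mul (AlgEquiv.restrictNormalHom E.1) σ τ
  rw [hm]

omit [NumberField F] in
/-- `σ|_E = (σ|_{E'})|_E` for layers `E ≤ E'`. [cite: Harari2020, §13.1] -/
theorem restrictNormal_restrictNormal {E E' : GalLayer F} (h : E ≤ E')
    (σ : AlgebraicClosure F ≃ₐ[F] AlgebraicClosure F) :
    (haveI := E.isGalois; haveI := E'.isGalois; letI := GalLayer.algebraOfLE h;
      haveI := GalLayer.isScalarTower_of_le h; (σ.restrictNormal E'.1).restrictNormal E.1) =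
      (haveI := E.isGalois; σ.restrictNormal E.1) := by
  haveI := E.isGalois
  haveI := E'.isGalois
  letI := GalLayer.algebraOfLE h
  haveI := GalLayer.isScalarTower_of_le h
  haveI := GalLayer.isScalarTower_of_le_top h
  exact (IsScalarTower.AlgEquiv.restrictNormalHom_comp_apply E.1 E'.1 σ).symm

/-- **The layer actions are compatible with the transition maps** (`g • ι(a) = ι(g|_E • a)`,
tree `classGalAct_classBaseChange_tower`). [cite: CasselsFrohlichANT1967, Ch. VII §1.1] -/
theorem transHom_layerAct {E E' : GalLayer F} (h : E ≤ E') (σ : AlgebraicClosure F ≃ₐ[F] AlgebraicClosure F)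
    (x : layerClass F E) : transHom E E' h (layerAct F E σ x) = layerAct F E' σ (transHom E E' h x) := by
  by_cases heq : E = E'
  · subst heq
    rw [transHom_self, transHom_self]
  rw [transHom_of_ne h heq]
  haveI := E.numberField
  haveI := E'.numberField
  haveI := E.isGalois
  haveI := E'.isGalois
  letI := GalLayer.algebraOfLE h
  haveI := GalLayer.isScalarTower_of_le h
  refine (Additive.toMul : Additive (IdeleClassGroup E'.1) ≃ IdeleClassGroup E'.1).injective ?_
  rw [toMul_baseChangeHom, toMul_layerAct, toMul_layerAct, toMul_baseChangeHom,
    classGalAct_classBaseChange_tower, restrictNormal_restrictNormal h σ]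

variable (F) in
/-- **The action of `σ ∈ Γ_F` on `C̄ = lim→ C_E`** (the limit of the layer actions). [cite: Harari2020, §13.1] -/
def barAct (σ : AlgebraicClosure F ≃ₐ[F] AlgebraicClosure F) : classBar F →+ classBar F :=
  AddCommGroup.DirectLimit.map (fun E => layerAct F E σ) fun _ _ h =>
    AddMonoidHom.ext fun x => (transHom_layerAct h σ x).symm

/-- `σ • [x]_E = [σ|_E • x]_E` in `C̄`. [cite: Harari2020, §13.1] -/
theorem barAct_ofLayer (σ : AlgebraicClosure F ≃ₐ[F] AlgebraicClosure F) (E : GalLayer F) (x : layerClass F E) :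
    barAct F σ (ofLayer F E x) = ofLayer F E (layerAct F E σ x) := by
  unfold barAct ofLayer
  rw [AddCommGroup.DirectLimit.map_apply_of]

/-- `1 ∈ Γ_F` acts trivially on `C̄`. [cite: Harari2020, §13.1] -/
theorem barAct_one (z : classBar F) : barAct F 1 z = z := by
  haveI := GalLayer.nonempty F
  haveI := GalLayer.isDirectedOrder F
  obtain ⟨E, x, rfl⟩ := exists_ofLayer z
  rw [barAct_ofLayer, layerAct_one]

/-- `(σ τ) • z = σ • (τ • z)` on `C̄`. [cite: Harari2020, §13.1] -/
theorem barAct_mul (σ τ : AlgebraicClosure F ≃ₐ[F] AlgebraicClosure F) (z : classBar F) :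
    barAct F (σ * τ) z = barAct F σ (barAct F τ z) := by
  obtain ⟨E, x, rfl⟩ := exists_ofLayer z
  rw [barAct_ofLayer, barAct_ofLayer, barAct_ofLayer, layerAct_mul]

variable (F) in
/-- **`C̄` as a `ℤ`-linear representation of `Γ_F = Gal(F̄/F)`** (the `G_k`-module `C` of Harari §13.1).
[cite: Harari2020, §13.1] -/
def barRep : Representation ℤ (AlgebraicClosure F ≃ₐ[F] AlgebraicClosure F) (classBar F) where
  toFun σ := (barAct F σ).toIntLinearMap
  map_one' := LinearMap.ext fun z => barAct_one z
  map_mul' σ τ := LinearMap.ext fun z => barAct_mul σ τ z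

/-- Formula: `barRep σ z = barAct σ z`. [cite: Harari2020, §13.1] -/
@[simp] theorem barRep_apply (σ : AlgebraicClosure F ≃ₐ[F] AlgebraicClosure F) (z : classBar F) :
    barRep F σ z = barAct F σ z :=
  rfl

/-- `barRep σ [x]_E = [σ|_E • x]_E`. [cite: Harari2020, §13.1] -/
theorem barRep_ofLayer (σ : AlgebraicClosure F ≃ₐ[F] AlgebraicClosure F) (E : GalLayer F) (x : layerClass F E) :
    barRep F σ (ofLayer F E x) = ofLayer F E (layerAct F E σ x) :=
  barAct_ofLayer σ E x

/-! ## §5. `C̄` is a discrete `Γ_F`-module: stabilisers contain the open subgroups `Gal(F̄/E)` -/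

omit [NumberField F] in
/-- `σ|_E = 1` for `σ ∈ Gal(F̄/E)`. [cite: Harari2020, §13.1] -/
theorem restrictNormal_eq_one_of_mem_fixingSubgroup (E : GalLayer F)
    {σ : AlgebraicClosure F ≃ₐ[F] AlgebraicClosure F} (hσ : σ ∈ E.1.fixingSubgroup) :
    (haveI := E.isGalois; σ.restrictNormal E.1) = 1 := by
  haveI := E.isGalois
  refine AlgEquiv.ext fun y => ?_
  apply (algebraMap E.1 (AlgebraicClosure F)).injective
  rw [AlgEquiv.restrictNormal_commutes, AlgEquiv.one_apply]
  exact (IntermediateField.mem_fixingSubgroup_iff _ _).1 hσ y.1 y.2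

/-- `Gal(F̄/E)` acts trivially on the layer `C_E`. [cite: Harari2020, §13.1] -/
theorem layerAct_eq_self_of_mem_fixingSubgroup (E : GalLayer F)
    {σ : AlgebraicClosure F ≃ₐ[F] AlgebraicClosure F} (hσ : σ ∈ E.1.fixingSubgroup) (x : layerClass F E) :
    layerAct F E σ x = x := by
  haveI := E.numberField
  haveI := E.isGalois
  rw [layerAct_apply, restrictNormal_eq_one_of_mem_fixingSubgroup E hσ, classGalAct_one_apply]
  rfl

/-- `Gal(F̄/E)` fixes the image of `C_E` in `C̄`. [cite: Harari2020, §13.1] -/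
theorem barRep_ofLayer_of_mem_fixingSubgroup (E : GalLayer F)
    {σ : AlgebraicClosure F ≃ₐ[F] AlgebraicClosure F} (hσ : σ ∈ E.1.fixingSubgroup) (x : layerClass F E) :
    barRep F σ (ofLayer F E x) = ofLayer F E x := by
  rw [barRep_ofLayer, layerAct_eq_self_of_mem_fixingSubgroup E hσ]

/-- **`C̄` is a discrete (smooth) `Γ_F`-module**: every `z ∈ C̄` is fixed by the open subgroup `Gal(F̄/E)` of some
layer `E` (Harari §13.1: `C` is a discrete `Γ_k`-module, being the limit of the `C_K = C^{Gal(k̄/K)}`).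
[cite: Harari2020, §13.1] -/
theorem exists_fixingSubgroup_le_stabilizer (z : classBar F) :
    ∃ E : GalLayer F, IsOpen (E.1.fixingSubgroup : Set (AlgebraicClosure F ≃ₐ[F] AlgebraicClosure F)) ∧
      ∀ σ ∈ E.1.fixingSubgroup, barRep F σ z = z := by
  obtain ⟨E, x, rfl⟩ := exists_ofLayer z
  haveI := E.finiteDimensional
  exact ⟨E, E.1.fixingSubgroup_isOpen, fun σ hσ => barRep_ofLayer_of_mem_fixingSubgroup E hσ x⟩

/-! ## §6. `H⁰(Gal(F̄/E), C̄) = C_E` -/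

/-- Galois descent inside the system: an element of `C_M` fixed by `Gal(M/E)` comes from `C_E` (tree
`exists_classBaseChange_eq_of_forall_classGalAct_eq`, Neukirch III (2.7)). [cite: Neukirch2013, Part III §2 (2.7)] -/
theorem exists_transHom_eq_of_forall_classGalAct_eq {E M : GalLayer F} (h : E ≤ M) (y : layerClass F M)
    (hy : haveI := M.numberField; letI := GalLayer.algebraOfLE h;
      ∀ τ : M.1 ≃ₐ[E.1] M.1, classGalAct τ (Additive.toMul y) = Additive.toMul y) :
    ∃ x : layerClass F E, transHom E M h x = y := by
  by_cases heq : E = M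
  · subst heq
    exact ⟨y, transHom_self E h y⟩
  haveI := E.numberField
  haveI := M.numberField
  haveI := E.isGalois
  haveI := M.isGalois
  letI := GalLayer.algebraOfLE h
  haveI := GalLayer.isScalarTower_of_le h
  haveI : IsGalois E.1 M.1 := IsGalois.tower_top_of_isGalois F E.1 M.1
  obtain ⟨a, ha⟩ := exists_classBaseChange_eq_of_forall_classGalAct_eq (M := E.1) (Additive.toMul y) hy
  refine ⟨(Additive.ofMul a : Additive (IdeleClassGroup E.1)), ?_⟩
  rw [transHom_of_ne h heq]
  refine (Additive.toMul : Additive (IdeleClassGroup M.1) ≃ IdeleClassGroup M.1).injective ?_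
  rw [toMul_baseChangeHom]
  exact ha

/-- Every `τ ∈ Gal(M/E)` is the restriction of some `σ ∈ Gal(F̄/E)`. [cite: Harari2020, §13.1] -/
theorem exists_restrictNormal_eq {E M : GalLayer F} (h : E ≤ M)
    (τ : haveI := GalLayer.algebraOfLE h; M.1 ≃ₐ[E.1] M.1) :
    ∃ σ : AlgebraicClosure F ≃ₐ[F] AlgebraicClosure F, σ ∈ E.1.fixingSubgroup ∧
      (haveI := M.isGalois; σ.restrictNormal M.1) =
        (letI := GalLayer.algebraOfLE h; haveI := GalLayer.isScalarTower_of_le h; τ.restrictScalars F) := by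
  haveI := M.isGalois
  letI := GalLayer.algebraOfLE h
  haveI := GalLayer.isScalarTower_of_le h
  obtain ⟨σ, hσ⟩ := AlgEquiv.restrictNormalHom_surjective (F := F) (K₁ := M.1)
    (E := AlgebraicClosure F) (τ.restrictScalars F)
  refine ⟨σ, (IntermediateField.mem_fixingSubgroup_iff _ _).2 fun x hx => ?_, hσ⟩
  have hc := AlgEquiv.restrictNormal_commutes σ M.1 (IntermediateField.inclusion h ⟨x, hx⟩)
  change algebraMap M.1 (AlgebraicClosure F) (AlgEquiv.restrictNormalHom M.1 σ _) = _ at hc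
  rw [hσ, AlgEquiv.restrictScalars_apply] at hc
  have hτ : τ (IntermediateField.inclusion h ⟨x, hx⟩) = IntermediateField.inclusion h ⟨x, hx⟩ :=
    τ.commutes (⟨x, hx⟩ : E.1)
  rw [hτ] at hc
  exact hc.symm

/-- **`H⁰(Gal(F̄/E), C̄) = C_E`**: an element of `C̄` fixed by `Gal(F̄/E)` lies in the image of `C_E` (and conversely,
`barRep_ofLayer_of_mem_fixingSubgroup`) — Harari §13.1 / Tate VII §8 Prop. 8.1 (`C_K → C_L^G` is bijective) in the
limit. [cite: Harari2020, §13.1][cite: CasselsFrohlichANT1967, Ch. VII §8 Prop. 8.1] -/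
theorem exists_ofLayer_eq_of_forall_mem_fixingSubgroup (E : GalLayer F) (z : classBar F)
    (hz : ∀ σ ∈ E.1.fixingSubgroup, barRep F σ z = z) : ∃ x : layerClass F E, ofLayer F E x = z := by
  obtain ⟨M₀, y₀, rfl⟩ := exists_ofLayer z
  obtain ⟨M, h, h₀⟩ := GalLayer.exists_ge_ge E M₀
  set y : layerClass F M := transHom M₀ M h₀ y₀ with hy_def
  have hyz : ofLayer F M y = ofLayer F M₀ y₀ := ofLayer_transHom h₀ y₀
  haveI := M.numberField
  haveI := M.isGalois
  letI := GalLayer.algebraOfLE h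
  haveI := GalLayer.isScalarTower_of_le h
  have hy : ∀ τ : M.1 ≃ₐ[E.1] M.1, classGalAct τ (Additive.toMul y) = Additive.toMul y := by
    intro τ
    obtain ⟨σ, hσE, hσ⟩ := exists_restrictNormal_eq h τ
    have h1 := hz σ hσE
    rw [← hyz, barRep_ofLayer] at h1
    have h2 : layerAct F M σ y = y := ofLayer_injective M h1
    rw [layerAct_apply, hσ, classGalAct_restrictScalars] at h2
    exact congrArg Additive.toMul h2
  obtain ⟨x, hx⟩ := exists_transHom_eq_of_forall_classGalAct_eq h y hy
  exact ⟨x, by rw [← hyz, ← hx, ofLayer_transHom]⟩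

/-- **`C̄^{Gal(F̄/E)} = C_E`** as an equality of sets: the fixed points of `Gal(F̄/E)` on `C̄` are exactly the image
of the layer `C_E`. [cite: Harari2020, §13.1] -/
theorem setOf_forall_mem_fixingSubgroup_eq_range (E : GalLayer F) :
    {z : classBar F | ∀ σ ∈ E.1.fixingSubgroup, barRep F σ z = z} = Set.range (ofLayer F E) := by
  ext z
  constructor
  · intro hz
    obtain ⟨x, hx⟩ := exists_ofLayer_eq_of_forall_mem_fixingSubgroup E z hz
    exact ⟨x, hx⟩
  · rintro ⟨x, rfl⟩ σ hσ
    exact barRep_ofLayer_of_mem_fixingSubgroup E hσ x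

/-- **`C̄^{Γ_F} = C_F`**: the `Γ_F`-invariants of `C̄` are the image of the bottom layer `C_F`
(`fixingSubgroup ⊥ = ⊤`). [cite: Harari2020, §13.1] -/
theorem setOf_forall_eq_range_bot :
    {z : classBar F | ∀ σ : AlgebraicClosure F ≃ₐ[F] AlgebraicClosure F, barRep F σ z = z} =
      Set.range (ofLayer F (GalLayer.bot F)) := by
  rw [← setOf_forall_mem_fixingSubgroup_eq_range]
  ext z
  simp only [Set.mem_setOf_eq]
  constructor
  · exact fun hz σ _ => hz σ
  · intro hz σ
    refine hz σ ((IntermediateField.mem_fixingSubgroup_iff _ _).2 fun x hx => ?_)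
    obtain ⟨a, rfl⟩ := IntermediateField.mem_bot.1 hx
    exact σ.commutes a

end IdeleClassBar

end Literature.NumberTheory.GaloisRepresentations

end
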